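import Mathlib
import Summits.ValiantsHypothesis.ValiantsHypothesis.Theorems.BarrierLeverPartitionMinorsHitByVPSimplexJoinPieceCount
import Summits.ValiantsHypothesis.ValiantsHypothesis.Theorems.BarrierLeverPartitionMinorsHitByVPSimplexJoinManyReduction
import Summits.ValiantsHypothesis.ValiantsHypothesis.Theorems.BarrierLeverPartitionMinorsHitByVPSimplexJoinDeepMany
import Summits.ValiantsHypothesis.ValiantsHypothesis.Theorems.BarrierLeverPartitionMinorsHitByVPSimplexJoinThreeLiveB
import Summits.ValiantsHypothesis.ValiantsHypothesis.Theorems.BarrierLeverPartitionMinorsHitByVPSimplexJoinFiveLive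

/-!
# Route BarrierLever — item `PartitionMinorsHitByVP` (19717): **the uniform simplex menu is refuted** (`not_uniformMenuSimplex`)
Helper file (`--supports stmt-ValiantsHypothesis-19717`; cell valiant-natproofs, 𝒟-side door (c), line `hidden_states`, uniform-menu
lane; prover seat val-np-p3 gen 12). Definition-free; closes NO item (it REFUTES the by-name-credited typed node
`SimplexJoin.Stmt.uniformMenuSimplex` of p623583, the "uniform simplex menu" half of the registered stub `stub_simplexPairLower`'s intended
proof; the registered stub itself and `Stmt.simplexUniversal` are NOT touched).
The DISPATCH of the case map (memo val-np-p3 g12 §2(f)–(j)): **`pieceKillMany_holds : Stmt.pieceKillMany (2^120)`** — count the live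
slots of the piece; ≥ 6: `pieceKill_sixLive`; 3/4/5: extract them sorted by size (`exists_sorted3/4/5`), read the levels of the sizes at
`univ` (`h+1`, `1+h+C(h,2)`), and apply the deep lemmas (`pieceKill_deep3/4/5`) or the shallow pattern theorems (`pieceKill3_p000/p100/
p110/p200`, `pieceKill4_shallow`, `pieceKill5_shallow`). Hence **`pieceKill_holds : Stmt.pieceKill (2^120)`** and
**`not_uniformMenuSimplex : ¬ Stmt.uniformMenuSimplex`** (via p637055 / p633734). Nothing on crux 14610 or VP ≠ VNP; item 19717 stays OPEN.
-/

set_option linter.dupNamespace false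

namespace Summit.ValiantsHypothesis.ValiantsHypothesis.Theorems.BarrierLever.SimplexJoin

open Finset Matrix

/-! ## Sorted extraction of 3, 4, 5 elements -/

/-- A 3-element finset, listed with `s` non-increasing. -/
theorem exists_sorted3 {α : Type*} [DecidableEq α] (L : Finset α) (s : α → ℕ) (hL : L.card = 3) :
    ∃ f₁ f₂ f₃, f₁ ≠ f₂ ∧ f₁ ≠ f₃ ∧ f₂ ≠ f₃ ∧ L = {f₁, f₂, f₃} ∧ s f₂ ≤ s f₁ ∧ s f₃ ≤ s f₂ := by
  obtain ⟨f₁, hf₁, hmax₁⟩ := Finset.exists_max_image L s (by rw [← Finset.card_pos]; omega)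
  have hL₁ : (L.erase f₁).card = 2 := by rw [Finset.card_erase_of_mem hf₁]; omega
  obtain ⟨f₂, hf₂, hmax₂⟩ := Finset.exists_max_image (L.erase f₁) s (by rw [← Finset.card_pos]; omega)
  have hL₂ : ((L.erase f₁).erase f₂).card = 1 := by rw [Finset.card_erase_of_mem hf₂]; omega
  obtain ⟨f₃, hf₃⟩ := Finset.card_eq_one.mp hL₂
  have hf₃mem : f₃ ∈ (L.erase f₁).erase f₂ := by rw [hf₃]; exact Finset.mem_singleton_self _
  have h32 : f₃ ≠ f₂ := (Finset.mem_erase.mp hf₃mem).1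
  have hf₃₁ : f₃ ∈ L.erase f₁ := (Finset.mem_erase.mp hf₃mem).2
  have h31 : f₃ ≠ f₁ := (Finset.mem_erase.mp hf₃₁).1
  have h21 : f₂ ≠ f₁ := (Finset.mem_erase.mp hf₂).1
  refine ⟨f₁, f₂, f₃, h21.symm, h31.symm, h32.symm, ?_, hmax₁ f₂ (Finset.mem_of_mem_erase hf₂), hmax₂ f₃ hf₃₁⟩
  rw [← Finset.insert_erase hf₁, ← Finset.insert_erase hf₂, hf₃]

/-- A 4-element finset, listed with `s` non-increasing. -/
theorem exists_sorted4 {α : Type*} [DecidableEq α] (L : Finset α) (s : α → ℕ) (hL : L.card = 4) :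
    ∃ f₁ f₂ f₃ f₄, f₁ ≠ f₂ ∧ f₁ ≠ f₃ ∧ f₁ ≠ f₄ ∧ f₂ ≠ f₃ ∧ f₂ ≠ f₄ ∧ f₃ ≠ f₄ ∧ L = {f₁, f₂, f₃, f₄} ∧
      s f₂ ≤ s f₁ ∧ s f₃ ≤ s f₂ ∧ s f₄ ≤ s f₃ := by
  obtain ⟨f₁, hf₁, hmax₁⟩ := Finset.exists_max_image L s (by rw [← Finset.card_pos]; omega)
  have hL₁ : (L.erase f₁).card = 3 := by rw [Finset.card_erase_of_mem hf₁]; omega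
  obtain ⟨f₂, f₃, f₄, h23, h24, h34, hEq, hs32, hs43⟩ := exists_sorted3 (L.erase f₁) s hL₁
  have hm : ∀ g, g ∈ L.erase f₁ ↔ g = f₂ ∨ g = f₃ ∨ g = f₄ := by
    intro g; rw [hEq]; simp
  have hf₂ : f₂ ∈ L.erase f₁ := (hm f₂).mpr (Or.inl rfl)
  have hf₃ : f₃ ∈ L.erase f₁ := (hm f₃).mpr (Or.inr (Or.inl rfl))
  have hf₄ : f₄ ∈ L.erase f₁ := (hm f₄).mpr (Or.inr (Or.inr rfl))
  refine ⟨f₁, f₂, f₃, f₄, (Finset.mem_erase.mp hf₂).1.symm, (Finset.mem_erase.mp hf₃).1.symm, (Finset.mem_erase.mp hf₄).1.symm,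
    h23, h24, h34, ?_, hmax₁ f₂ (Finset.mem_of_mem_erase hf₂), hs32, hs43⟩
  rw [← Finset.insert_erase hf₁, hEq]

/-- A 5-element finset, listed with `s` non-increasing. -/
theorem exists_sorted5 {α : Type*} [DecidableEq α] (L : Finset α) (s : α → ℕ) (hL : L.card = 5) :
    ∃ f₁ f₂ f₃ f₄ f₅, f₁ ≠ f₂ ∧ f₁ ≠ f₃ ∧ f₁ ≠ f₄ ∧ f₁ ≠ f₅ ∧ f₂ ≠ f₃ ∧ f₂ ≠ f₄ ∧ f₂ ≠ f₅ ∧ f₃ ≠ f₄ ∧ f₃ ≠ f₅ ∧ f₄ ≠ f₅ ∧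
      L = {f₁, f₂, f₃, f₄, f₅} ∧ s f₂ ≤ s f₁ ∧ s f₃ ≤ s f₂ ∧ s f₄ ≤ s f₃ ∧ s f₅ ≤ s f₄ := by
  obtain ⟨f₁, hf₁, hmax₁⟩ := Finset.exists_max_image L s (by rw [← Finset.card_pos]; omega)
  have hL₁ : (L.erase f₁).card = 4 := by rw [Finset.card_erase_of_mem hf₁]; omega
  obtain ⟨f₂, f₃, f₄, f₅, h23, h24, h25, h34, h35, h45, hEq, hs32, hs43, hs54⟩ := exists_sorted4 (L.erase f₁) s hL₁
  have hm : ∀ g, g ∈ L.erase f₁ ↔ g = f₂ ∨ g = f₃ ∨ g = f₄ ∨ g = f₅ := by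
    intro g; rw [hEq]; simp
  have hf₂ : f₂ ∈ L.erase f₁ := (hm f₂).mpr (Or.inl rfl)
  have hf₃ : f₃ ∈ L.erase f₁ := (hm f₃).mpr (Or.inr (Or.inl rfl))
  have hf₄ : f₄ ∈ L.erase f₁ := (hm f₄).mpr (Or.inr (Or.inr (Or.inl rfl)))
  have hf₅ : f₅ ∈ L.erase f₁ := (hm f₅).mpr (Or.inr (Or.inr (Or.inr rfl)))
  refine ⟨f₁, f₂, f₃, f₄, f₅, (Finset.mem_erase.mp hf₂).1.symm, (Finset.mem_erase.mp hf₃).1.symm,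
    (Finset.mem_erase.mp hf₄).1.symm, (Finset.mem_erase.mp hf₅).1.symm, h23, h24, h25, h34, h35, h45, ?_,
    hmax₁ f₂ (Finset.mem_of_mem_erase hf₂), hs32, hs43, hs54⟩
  rw [← Finset.insert_erase hf₁, hEq]

/-! ## The dispatch -/

/-- **`Stmt.pieceKillMany (2^120)` holds.** -/
theorem pieceKillMany_holds : Stmt.pieceKillMany (2 ^ 120) := by
  classical
  intro h hh D N n S e hD hN he hlive hthree hnlo hnhi
  have h12 : 2 ^ 12 ≤ h := le_trans (by norm_num) hh
  -- the live slots and the column count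
  set L := Finset.univ.filter (fun f : Fin D => (S 0 f).Nonempty) with hL
  have hdead : ∀ f, f ∉ L → S 0 f = ∅ := fun f hf =>
    Finset.not_nonempty_iff_eq_empty.mp fun hne => hf (Finset.mem_filter.mpr ⟨Finset.mem_univ _, hne⟩)
  have hliveL : ∀ f, f ∈ L → 1 ≤ (S 0 f).card := fun f hf => Finset.card_pos.mpr (Finset.mem_filter.mp hf).2
  have hprod : n = ∏ f ∈ L, ((S 0 f).card + 1) := by
    rw [card_columns_eq_prod S e he hlive]
    exact (Finset.prod_subset (Finset.subset_univ L) fun f _ hf => by rw [hdead f hf]; simp).symm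
  have hcardN : ∀ f, (S 0 f).card ≤ (h + h) ^ 2 := fun f => (Finset.card_le_univ _).trans (by simp; exact hN)
  -- levels
  have hc₂ : h + 1 ≤ ∑ i ∈ Finset.range 3, h.choose i := by
    simp [Finset.sum_range_succ]; omega
  have hl0 : ∀ s : ℕ, 1 ≤ s → ∑ i ∈ Finset.range (0 + 1), h.choose i ≤ s := fun s hs => by simpa using hs
  have hl1 : ∀ s : ℕ, h + 1 ≤ s → ∑ i ∈ Finset.range (1 + 1), h.choose i ≤ s := fun s hs => by
    simp [Finset.sum_range_succ]; omega
  by_cases h6 : 6 ≤ L.card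
  · exact pieceKill_sixLive h h12 S e he hlive h6 hnhi
  push Not at h6
  have hk : L.card = 3 ∨ L.card = 4 ∨ L.card = 5 := by omega
  rcases hk with hk | hk | hk
  · -- THREE live slots
    obtain ⟨f₁, f₂, f₃, h12', h13, h23, hLeq, hs21, hs32⟩ := exists_sorted3 L (fun f => (S 0 f).card) hk
    have hm : ∀ g, g ∈ L ↔ g = f₁ ∨ g = f₂ ∨ g = f₃ := by intro g; rw [hLeq]; simp
    have hs₃ : 1 ≤ (S 0 f₃).card := hliveL f₃ ((hm f₃).mpr (Or.inr (Or.inr rfl)))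
    have hn : n = ((S 0 f₁).card + 1) * ((S 0 f₂).card + 1) * ((S 0 f₃).card + 1) := by
      rw [hprod, hLeq, Finset.prod_insert (by simp [h12', h13]), Finset.prod_insert (by simp [h23]), Finset.prod_singleton, mul_assoc]
    by_cases hA : (S 0 f₁).card ≤ h
    · exact pieceKill3_p000 h (le_trans (by norm_num) hh) S e he hlive f₁ f₂ f₃ h12' h13 h23 hA hs21 hs32 hs₃ hn hnlo
    push Not at hA
    by_cases hB : (S 0 f₁).card < ∑ i ∈ Finset.range 3, h.choose i
    · by_cases hC : (S 0 f₂).card ≤ h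
      · exact pieceKill3_p100 h (le_trans (by norm_num) hh) S e he hlive f₁ f₂ f₃ h12' h13 h23 (by omega) hB hC hs32 hs₃ hn
      push Not at hC
      by_cases hD3 : (S 0 f₃).card ≤ h
      · exact pieceKill3_p110 h hh S e he hlive f₁ f₂ f₃ h12' h13 h23 hB (by omega) hs21 hD3 hs₃ hn
      · -- (1,1,1): deep
        push Not at hD3
        exact pieceKill_deep3 h 1 1 1 h12 (by norm_num) S e he hlive f₁ f₂ f₃ h12' h13 h23
          (hl1 _ (by omega)) (hl1 _ (by omega)) (hl1 _ (by omega)) hnhi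
    · push Not at hB
      by_cases hC : (S 0 f₂).card ≤ h
      · exact pieceKill3_p200 h (le_trans (by norm_num) hh) S e he hlive f₁ f₂ f₃ h12' h13 h23 hB (hcardN f₁) hC hs32 hs₃ hn
      · -- (2,1,0): deep
        push Not at hC
        exact pieceKill_deep3 h 2 1 0 h12 (by norm_num) S e he hlive f₁ f₂ f₃ h12' h13 h23 hB (hl1 _ (by omega)) (hl0 _ hs₃) hnhi
  · -- FOUR live slots
    obtain ⟨f₁, f₂, f₃, f₄, h12', h13, h14, h23, h24, h34, hLeq, hs21, hs32, hs43⟩ :=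
      exists_sorted4 L (fun f => (S 0 f).card) hk
    have hm : ∀ g, g ∈ L ↔ g = f₁ ∨ g = f₂ ∨ g = f₃ ∨ g = f₄ := by intro g; rw [hLeq]; simp
    have hs₄ : 1 ≤ (S 0 f₄).card := hliveL f₄ ((hm f₄).mpr (Or.inr (Or.inr (Or.inr rfl))))
    have hn : n = ((S 0 f₁).card + 1) * ((S 0 f₂).card + 1) * ((S 0 f₃).card + 1) * ((S 0 f₄).card + 1) := by
      rw [hprod, hLeq, Finset.prod_insert (by simp [h12', h13, h14]), Finset.prod_insert (by simp [h23, h24]),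
        Finset.prod_insert (by simp [h34]), Finset.prod_singleton]; ring
    by_cases hB : (S 0 f₁).card < ∑ i ∈ Finset.range 3, h.choose i
    · by_cases hC : (S 0 f₂).card ≤ h
      · exact pieceKill4_shallow h (le_trans (by norm_num) hh) S e he hlive f₁ f₂ f₃ f₄ h12' h13 h14 h23 h24 h34 hB hC
          hs21 hs32 hs43 hs₄ hn hnlo
      · -- (1,1,0,0) or deeper: deep
        push Not at hC
        exact pieceKill_deep4 h 1 1 0 0 h12 (by norm_num) S e he hlive f₁ f₂ f₃ f₄ h12' h13 h14 h23 h24 h34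
          (hl1 _ (by omega)) (hl1 _ (by omega)) (hl0 _ (by omega)) (hl0 _ hs₄) hnhi
    · -- (2,0,0,0) or deeper: deep
      push Not at hB
      exact pieceKill_deep4 h 2 0 0 0 h12 (by norm_num) S e he hlive f₁ f₂ f₃ f₄ h12' h13 h14 h23 h24 h34
        hB (hl0 _ (by omega)) (hl0 _ (by omega)) (hl0 _ hs₄) hnhi
  · -- FIVE live slots
    obtain ⟨f₁, f₂, f₃, f₄, f₅, h12', h13, h14, h15, h23, h24, h25, h34, h35, h45, hLeq, hs21, hs32, hs43, hs54⟩ :=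
      exists_sorted5 L (fun f => (S 0 f).card) hk
    have hm : ∀ g, g ∈ L ↔ g = f₁ ∨ g = f₂ ∨ g = f₃ ∨ g = f₄ ∨ g = f₅ := by intro g; rw [hLeq]; simp
    have hs₅ : 1 ≤ (S 0 f₅).card := hliveL f₅ ((hm f₅).mpr (Or.inr (Or.inr (Or.inr (Or.inr rfl)))))
    have hn : n = ((S 0 f₁).card + 1) * ((S 0 f₂).card + 1) * ((S 0 f₃).card + 1) * ((S 0 f₄).card + 1) *
        ((S 0 f₅).card + 1) := by
      rw [hprod, hLeq, Finset.prod_insert (by simp [h12', h13, h14, h15]), Finset.prod_insert (by simp [h23, h24, h25]),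
        Finset.prod_insert (by simp [h34, h35]), Finset.prod_insert (by simp [h45]), Finset.prod_singleton]; ring
    by_cases hA : (S 0 f₁).card ≤ h
    · exact pieceKill5_shallow h (le_trans (by norm_num) hh) S e he hlive f₁ f₂ f₃ f₄ f₅ h12' h13 h14 h15 h23 h24 h25 h34 h35 h45
        (by omega) (by omega) hs21 hs32 hs43 hs54 hs₅ hn hnlo
    · -- (1,0,0,0,0) or deeper: deep
      push Not at hA
      exact pieceKill_deep5 h 1 0 0 0 0 h12 (by norm_num) S e he hlive f₁ f₂ f₃ f₄ f₅ h12' h13 h14 h15 h23 h24 h25 h34 h35 h45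
        (hl1 _ (by omega)) (hl0 _ (by omega)) (hl0 _ (by omega)) (hl0 _ (by omega)) (hl0 _ hs₅) hnhi

/-- **`Stmt.pieceKill (2^120)` holds.** -/
theorem pieceKill_holds : Stmt.pieceKill (2 ^ 120) := by
  have := pieceKill_of_pieceKillMany (2 ^ 120) pieceKillMany_holds
  rwa [show max (2 ^ 120) (2 ^ 40) = (2 : ℕ) ^ 120 from max_eq_left (by norm_num)] at this

/-- **The uniform simplex menu (`SimplexJoin.Stmt.uniformMenuSimplex`, typed in p623583) is FALSE.** For every `h₁` there are `h ≥ h₁`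
and `r ≤ 2^h` (namely `r = (2h)²((2h)²+1)+1`) such that every simplex-product design with `≤ (2h)²` pieces, `≤ 2h` slots and widths
`≤ (2h)²` has a piece on which some injective row family makes every table singular. -/
theorem not_uniformMenuSimplex : ¬ Stmt.uniformMenuSimplex :=
  not_uniformMenuSimplex_of_pieceKillMany _ pieceKillMany_holds

end Summit.ValiantsHypothesis.ValiantsHypothesis.Theorems.BarrierLever.SimplexJoin
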